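import Summits.CriticalPhenomena.PercolationContinuityZ3.Theorems.PercNearOneGluingAdditiveGluingBystanderReach
import Summits.CriticalPhenomena.PercolationContinuityZ3.Theorems.PercNearOneGluingAdditiveGluingBystanderDesignated
import Summits.CriticalPhenomena.PercolationContinuityZ3.Theorems.PercNearOneGluingAdditiveGluingBystanderPockets
import HarnessLib

/-! # Crux `PercNearOneGluing.AdditiveGluing` (stmt-CriticalPhenomena-4576), line `peel` — BYSTANDER ATTACHMENT at a fixed designation

Lead c5; lands `--supports stmt-CriticalPhenomena-4576`.  No definitions, no named facts.

`blockGood_insert_of_layers`: for a weighting `u`, relays `A ∋ b`, a block `T ∌ x` and ANY designation `d ∉ {x}`: if for every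
possible open star `B` of `x` the block `T ∪ B` is `d`-good (block form, worst selection) in the weighting `q_B` (= `u` with the star
of `x` killed and the pairs inside `B` glued), then the block `insert x T` is `d`-good in `u`.  Proof: the three bystander σ-identities
(`stub_bystanderReach_c5`, `stub_bystanderDesignated_c5`, `stub_bystanderPockets_c5`: reach, glued designation reliability and the
worst-selection pocket sum of `insert x T` are the `μ_u(layer_B)`-weighted sums of the same quantities for `T ∪ B` in `q_B`) and a
termwise comparison.  Consequence for the cone stub `stub_conePeel` (LeadMath-c5 §F): with `d := a'` a minimiser of `μ_{u−x}(· ↔ b)`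
every hypothesis `hB` is an induction-hypothesis instance (bad blocks) or the Lemma-5 leaf `blockGood_leaf_lemma5`, so
`K^{a₀}_{T∪x}(u) = K^{a'}_{T∪x}(u) − [τ_{u/(T∪x)}(a₀) − τ_{u/(T∪x)}(a')] ≥ −[τ_{u/(T∪x)}(a₀) − τ_{u/(T∪x)}(a')]`: the cone step can
fail only under "double drift".
[cite: KozmaNitzan2024, §3.2 (proofs of Thms 4–5, pp. 13–14), Question 9 (p. 36)]
-/

namespace Summit.CriticalPhenomena.PercolationContinuityZ3.Theorems

open MeasureTheory Set
open Literature.Probability.LatticeModels (prodBernoulli)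
open Literature.Probability.Percolation (BondConfig openConn openConnIn openGraph openCluster)
open scoped BigOperators Classical

noncomputable section

variable {n : ℕ}

/-- **Bystander attachment at a fixed designation.**  If every layer block `T ∪ B` is `d`-good in `q_B` (star of `x` killed, `B` glued),
then `insert x T` is `d`-good in `u` (block form, worst selection). [cite: KozmaNitzan2024, §3.2 pp. 13–14] -/
theorem blockGood_insert_of_layers (u : Sym2 (Fin n) → unitInterval) (A T : Finset (Fin n)) (x b d : Fin n)
    (hb : b ∈ A) (hxT : x ∉ T) (hxA : x ∉ A) (hdx : d ≠ x)
    (hB : ∀ B : Finset (Fin n),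
      (prodBernoulli u).real
          {ω : BondConfig (Fin n) | ∀ y : Fin n, y ∈ B ↔ (y ∉ ({x} : Finset (Fin n)) ∧
            ∃ o ∈ ({x} : Finset (Fin n)), s(o, y) ∈ ω)} ≠ 0 →
      (prodBernoulli (fun e : Sym2 (Fin n) =>
          if (∀ y ∈ e, y ∈ B) ∧ ¬ e.IsDiag then 1 else
            if (∃ y ∈ e, y ∈ ({x} : Finset (Fin n))) then 0 else u e)).real (openConn d b)
        + (prodBernoulli (fun e : Sym2 (Fin n) =>
          if (∀ y ∈ e, y ∈ B) ∧ ¬ e.IsDiag then 1 else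
            if (∃ y ∈ e, y ∈ ({x} : Finset (Fin n))) then 0 else u e)).real
            ((openConn d b)ᶜ ∩ (⋃ v ∈ T ∪ B, openConn d v) ∩ (⋃ v ∈ T ∪ B, openConn v b))
      ≤ (prodBernoulli (fun e : Sym2 (Fin n) =>
          if (∀ y ∈ e, y ∈ B) ∧ ¬ e.IsDiag then 1 else
            if (∃ y ∈ e, y ∈ ({x} : Finset (Fin n))) then 0 else u e)).real (⋃ v ∈ T ∪ B, openConn v b)
        + ∑ W ∈ (Finset.univ : Finset (Finset (Fin n))).filter (fun W => Disjoint W A),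
            (prodBernoulli (fun e : Sym2 (Fin n) =>
                if (∀ y ∈ e, y ∈ B) ∧ ¬ e.IsDiag then 1 else
                  if (∃ y ∈ e, y ∈ ({x} : Finset (Fin n))) then 0 else u e)).real
                {ω : BondConfig (Fin n) | ∀ z : Fin n, (z ∈ W ↔ ω ∈ ⋃ v ∈ T ∪ B, openConn v z)}
              * A.inf' ⟨b, hb⟩ (fun a => (prodBernoulli (fun e : Sym2 (Fin n) =>
                  if (∀ y ∈ e, y ∈ B) ∧ ¬ e.IsDiag then 1 else
                    if (∃ y ∈ e, y ∈ ({x} : Finset (Fin n))) then 0 else u e)).real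
                  (openConnIn ((W : Set (Fin n))ᶜ) a b))) :
    (prodBernoulli u).real (openConn d b)
        + (prodBernoulli u).real
            ((openConn d b)ᶜ ∩ (⋃ v ∈ insert x T, openConn d v) ∩ (⋃ v ∈ insert x T, openConn v b))
      ≤ (prodBernoulli u).real (⋃ v ∈ insert x T, openConn v b)
        + ∑ W ∈ (Finset.univ : Finset (Finset (Fin n))).filter (fun W => Disjoint W A),
            (prodBernoulli u).real
                {ω : BondConfig (Fin n) | ∀ z : Fin n, (z ∈ W ↔ ω ∈ ⋃ v ∈ insert x T, openConn v z)}
              * A.inf' ⟨b, hb⟩ (fun a => (prodBernoulli u).real (openConnIn ((W : Set (Fin n))ᶜ) a b)) := by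
  have hbx : b ≠ x := fun h => hxA (h ▸ hb)
  rw [stub_bystanderDesignated_c5 n u T x b d hxT hbx hdx, stub_bystanderReach_c5 n u T x b hxT hbx,
    stub_bystanderPockets_c5 n u A T x b hb hxT hxA, ← Finset.sum_add_distrib]
  refine Finset.sum_le_sum fun B _ => ?_
  rw [← mul_add]
  by_cases h0 : (prodBernoulli u).real
      {ω : BondConfig (Fin n) | ∀ y : Fin n, y ∈ B ↔ (y ∉ ({x} : Finset (Fin n)) ∧
        ∃ o ∈ ({x} : Finset (Fin n)), s(o, y) ∈ ω)} = 0
  · rw [h0, zero_mul, zero_mul]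
  · exact mul_le_mul_of_nonneg_left (hB B h0) measureReal_nonneg


/-- The star-killed-and-glued layer weighting `q_B` is the gluing of `B` in the star-killed weighting `u − x`. [folklore] -/
theorem bystG_qB_eq (u : Sym2 (Fin n) → unitInterval) (B : Finset (Fin n)) (x : Fin n) :
    (fun e : Sym2 (Fin n) => if (∀ y ∈ e, y ∈ B) ∧ ¬ e.IsDiag then (1 : unitInterval) else
        if (∃ y ∈ e, y ∈ ({x} : Finset (Fin n))) then 0 else u e)
      = (fun e : Sym2 (Fin n) => if (∀ y ∈ e, y ∈ B) ∧ ¬ e.IsDiag then (1 : unitInterval) else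
          (fun e : Sym2 (Fin n) => if (∃ y ∈ e, y ∈ ({x} : Finset (Fin n))) then (0 : unitInterval) else u e) e) := rfl

/-- **Layer goodness from un-glued goodness.**  `d`-goodness of the block `T ∪ B` in the star-killed weighting `u − x` gives the
hypothesis `hB` of `blockGood_insert_of_layers` (the same inequality in `q_B` = `(u − x)/B`): gluing `B ⊆ T ∪ B` changes neither the
block's reach, nor its cluster law, nor the pocket factors, nor the glued designation reliability. [cite: KozmaNitzan2024, §3.1 Remark p. 5] -/
theorem bystG_layer_of_unglued (u : Sym2 (Fin n) → unitInterval) (A T B : Finset (Fin n)) (x b d : Fin n) (hb : b ∈ A)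
    (h : (prodBernoulli (fun e : Sym2 (Fin n) => if (∃ y ∈ e, y ∈ ({x} : Finset (Fin n))) then (0 : unitInterval) else u e)).real
          (openConn d b)
        + (prodBernoulli (fun e : Sym2 (Fin n) => if (∃ y ∈ e, y ∈ ({x} : Finset (Fin n))) then (0 : unitInterval) else u e)).real
            ((openConn d b)ᶜ ∩ (⋃ v ∈ T ∪ B, openConn d v) ∩ (⋃ v ∈ T ∪ B, openConn v b))
      ≤ (prodBernoulli (fun e : Sym2 (Fin n) => if (∃ y ∈ e, y ∈ ({x} : Finset (Fin n))) then (0 : unitInterval) else u e)).real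
          (⋃ v ∈ T ∪ B, openConn v b)
        + ∑ W ∈ (Finset.univ : Finset (Finset (Fin n))).filter (fun W => Disjoint W A),
            (prodBernoulli (fun e : Sym2 (Fin n) => if (∃ y ∈ e, y ∈ ({x} : Finset (Fin n))) then (0 : unitInterval) else u e)).real
                {ω : BondConfig (Fin n) | ∀ z : Fin n, (z ∈ W ↔ ω ∈ ⋃ v ∈ T ∪ B, openConn v z)}
              * A.inf' ⟨b, hb⟩ (fun a =>
                (prodBernoulli (fun e : Sym2 (Fin n) => if (∃ y ∈ e, y ∈ ({x} : Finset (Fin n))) then (0 : unitInterval) else u e)).real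
                  (openConnIn ((W : Set (Fin n))ᶜ) a b))) :
    (prodBernoulli (fun e : Sym2 (Fin n) =>
        if (∀ y ∈ e, y ∈ B) ∧ ¬ e.IsDiag then 1 else
          if (∃ y ∈ e, y ∈ ({x} : Finset (Fin n))) then 0 else u e)).real (openConn d b)
      + (prodBernoulli (fun e : Sym2 (Fin n) =>
        if (∀ y ∈ e, y ∈ B) ∧ ¬ e.IsDiag then 1 else
          if (∃ y ∈ e, y ∈ ({x} : Finset (Fin n))) then 0 else u e)).real
          ((openConn d b)ᶜ ∩ (⋃ v ∈ T ∪ B, openConn d v) ∩ (⋃ v ∈ T ∪ B, openConn v b))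
    ≤ (prodBernoulli (fun e : Sym2 (Fin n) =>
        if (∀ y ∈ e, y ∈ B) ∧ ¬ e.IsDiag then 1 else
          if (∃ y ∈ e, y ∈ ({x} : Finset (Fin n))) then 0 else u e)).real (⋃ v ∈ T ∪ B, openConn v b)
      + ∑ W ∈ (Finset.univ : Finset (Finset (Fin n))).filter (fun W => Disjoint W A),
          (prodBernoulli (fun e : Sym2 (Fin n) =>
              if (∀ y ∈ e, y ∈ B) ∧ ¬ e.IsDiag then 1 else
                if (∃ y ∈ e, y ∈ ({x} : Finset (Fin n))) then 0 else u e)).real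
              {ω : BondConfig (Fin n) | ∀ z : Fin n, (z ∈ W ↔ ω ∈ ⋃ v ∈ T ∪ B, openConn v z)}
            * A.inf' ⟨b, hb⟩ (fun a => (prodBernoulli (fun e : Sym2 (Fin n) =>
                if (∀ y ∈ e, y ∈ B) ∧ ¬ e.IsDiag then 1 else
                  if (∃ y ∈ e, y ∈ ({x} : Finset (Fin n))) then 0 else u e)).real
                (openConnIn ((W : Set (Fin n))ᶜ) a b)) := by
  set v : Sym2 (Fin n) → unitInterval :=
    fun e => if (∃ y ∈ e, y ∈ ({x} : Finset (Fin n))) then (0 : unitInterval) else u e with hv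
  have hBS : B ⊆ T ∪ B := Finset.subset_union_right
  rw [bystG_qB_eq u B x]
  -- reach and cluster law of the super-block `T ∪ B` are glue-invariant; so are the pocket factors
  rw [peelGlue_real_iUnion_superset v B (T ∪ B) hBS b]
  have hP : ∀ W, (prodBernoulli (fun e : Sym2 (Fin n) => if (∀ y ∈ e, y ∈ B) ∧ ¬ e.IsDiag then 1 else v e)).real
        {ω : BondConfig (Fin n) | ∀ z : Fin n, (z ∈ W ↔ ω ∈ ⋃ v ∈ T ∪ B, openConn v z)}
      = (prodBernoulli v).real {ω : BondConfig (Fin n) | ∀ z : Fin n, (z ∈ W ↔ ω ∈ ⋃ v ∈ T ∪ B, openConn v z)} :=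
    fun W => peelGlue_real_pocket_superset v B (T ∪ B) W hBS
  rw [peelGlue_pocketSum_eq v A B (T ∪ B) hBS b hb _ hP]
  -- the glued designation reliability: `(v/B)/(T ∪ B) = v/(T ∪ B)`
  have hglue : (fun e : Sym2 (Fin n) => if (∀ y ∈ e, y ∈ T ∪ B) ∧ ¬ e.IsDiag then (1 : unitInterval) else
        (fun e : Sym2 (Fin n) => if (∀ y ∈ e, y ∈ B) ∧ ¬ e.IsDiag then (1 : unitInterval) else v e) e)
      = (fun e : Sym2 (Fin n) => if (∀ y ∈ e, y ∈ T ∪ B) ∧ ¬ e.IsDiag then (1 : unitInterval) else v e) := by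
    funext e
    dsimp only
    by_cases h1 : (∀ y ∈ e, y ∈ T ∪ B) ∧ ¬ e.IsDiag
    · rw [if_pos h1, if_pos h1]
    · rw [if_neg h1, if_neg h1, if_neg]
      rintro ⟨hin, hd⟩
      exact h1 ⟨fun y hy => hBS (hin y hy), hd⟩
  have hdes : (prodBernoulli (fun e : Sym2 (Fin n) => if (∀ y ∈ e, y ∈ B) ∧ ¬ e.IsDiag then 1 else v e)).real (openConn d b)
      + (prodBernoulli (fun e : Sym2 (Fin n) => if (∀ y ∈ e, y ∈ B) ∧ ¬ e.IsDiag then 1 else v e)).real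
          ((openConn d b)ᶜ ∩ (⋃ v ∈ T ∪ B, openConn d v) ∩ (⋃ v ∈ T ∪ B, openConn v b))
      = (prodBernoulli v).real (openConn d b)
        + (prodBernoulli v).real ((openConn d b)ᶜ ∩ (⋃ v ∈ T ∪ B, openConn d v) ∩ (⋃ v ∈ T ∪ B, openConn v b)) := by
    rw [← blockGrowth_glue_real_openConn, ← blockGrowth_glue_real_openConn, hglue]
  rw [hdes]
  exact h

/-- **Bystander attachment at a fixed designation, un-glued form.**  For ANY designation `d ≠ x`: if every block `T ∪ B` is
`d`-good in the star-killed weighting `u − x`, then `insert x T` is `d`-good in `u` (block form, worst selection).  With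
`d` a minimiser of `μ_{u−x}(· ↔ b)` the hypothesis is block goodness at the argmin of the SMALLER weighting (an induction-hypothesis
instance for bad blocks, the Lemma-5 leaf otherwise), so the cone step `stub_conePeel` holds at `a₀ = argmin τ_u` whenever
`τ_{u/(T∪x)}(a₀) ≤ τ_{u/(T∪x)}(d)` (no "double drift", LeadMath-c5 §F). [cite: KozmaNitzan2024, §3.2 pp. 13–14, Question 9 p. 36] -/
theorem blockGood_insert_of_unglued (u : Sym2 (Fin n) → unitInterval) (A T : Finset (Fin n)) (x b d : Fin n)
    (hb : b ∈ A) (hxT : x ∉ T) (hxA : x ∉ A) (hdx : d ≠ x)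
    (hU : ∀ B : Finset (Fin n),
      (prodBernoulli u).real
          {ω : BondConfig (Fin n) | ∀ y : Fin n, y ∈ B ↔ (y ∉ ({x} : Finset (Fin n)) ∧
            ∃ o ∈ ({x} : Finset (Fin n)), s(o, y) ∈ ω)} ≠ 0 →
      (prodBernoulli (fun e : Sym2 (Fin n) => if (∃ y ∈ e, y ∈ ({x} : Finset (Fin n))) then (0 : unitInterval) else u e)).real
          (openConn d b)
        + (prodBernoulli (fun e : Sym2 (Fin n) => if (∃ y ∈ e, y ∈ ({x} : Finset (Fin n))) then (0 : unitInterval) else u e)).real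
            ((openConn d b)ᶜ ∩ (⋃ v ∈ T ∪ B, openConn d v) ∩ (⋃ v ∈ T ∪ B, openConn v b))
      ≤ (prodBernoulli (fun e : Sym2 (Fin n) => if (∃ y ∈ e, y ∈ ({x} : Finset (Fin n))) then (0 : unitInterval) else u e)).real
          (⋃ v ∈ T ∪ B, openConn v b)
        + ∑ W ∈ (Finset.univ : Finset (Finset (Fin n))).filter (fun W => Disjoint W A),
            (prodBernoulli (fun e : Sym2 (Fin n) => if (∃ y ∈ e, y ∈ ({x} : Finset (Fin n))) then (0 : unitInterval) else u e)).real
                {ω : BondConfig (Fin n) | ∀ z : Fin n, (z ∈ W ↔ ω ∈ ⋃ v ∈ T ∪ B, openConn v z)}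
              * A.inf' ⟨b, hb⟩ (fun a =>
                (prodBernoulli (fun e : Sym2 (Fin n) => if (∃ y ∈ e, y ∈ ({x} : Finset (Fin n))) then (0 : unitInterval) else u e)).real
                  (openConnIn ((W : Set (Fin n))ᶜ) a b))) :
    (prodBernoulli u).real (openConn d b)
        + (prodBernoulli u).real
            ((openConn d b)ᶜ ∩ (⋃ v ∈ insert x T, openConn d v) ∩ (⋃ v ∈ insert x T, openConn v b))
      ≤ (prodBernoulli u).real (⋃ v ∈ insert x T, openConn v b)
        + ∑ W ∈ (Finset.univ : Finset (Finset (Fin n))).filter (fun W => Disjoint W A),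
            (prodBernoulli u).real
                {ω : BondConfig (Fin n) | ∀ z : Fin n, (z ∈ W ↔ ω ∈ ⋃ v ∈ insert x T, openConn v z)}
              * A.inf' ⟨b, hb⟩ (fun a => (prodBernoulli u).real (openConnIn ((W : Set (Fin n))ᶜ) a b)) :=
  blockGood_insert_of_layers u A T x b d hb hxT hxA hdx fun B hB0 => bystG_layer_of_unglued u A T B x b d hb (hU B hB0)


/-- **Bystander attachment, WEIGHTED-LAYER form.**  If reals `c_B` have a non-negative `μ_u(layer_B)`-weighted sum and each `c_B` (on
a layer of positive mass) is at most the layer block's `reach + pockets − designated(d)` in `q_B`, then `insert x T` is `d`-good in `u`.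
(`blockGood_insert_of_layers` is the case `c = 0`.)  This is the form the pocket-free residual of skeleton v5 (`stub_relayLayersPayDrift`)
plugs into. [cite: KozmaNitzan2024, §3.2 pp. 13–14] -/
theorem blockGood_insert_of_layers_weighted :
    ∀ (n : ℕ) (u : Sym2 (Fin n) → unitInterval) (A T : Finset (Fin n)) (x b d : Fin n) (hb : b ∈ A)
      (c : Finset (Fin n) → ℝ),
      x ∉ T → x ∉ A → d ≠ x →
      0 ≤ ∑ B : Finset (Fin n), (prodBernoulli u).real {ω : BondConfig (Fin n) | ∀ y : Fin n, y ∈ B ↔ (y ∉ ({x} : Finset (Fin n)) ∧ ∃ o ∈ ({x} : Finset (Fin n)), s(o, y) ∈ ω)} * c B →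
      (∀ B : Finset (Fin n), (prodBernoulli u).real {ω : BondConfig (Fin n) | ∀ y : Fin n, y ∈ B ↔ (y ∉ ({x} : Finset (Fin n)) ∧ ∃ o ∈ ({x} : Finset (Fin n)), s(o, y) ∈ ω)} ≠ 0 →
        c B ≤ (prodBernoulli (fun e : Sym2 (Fin n) => if (∀ y ∈ e, y ∈ B) ∧ ¬ e.IsDiag then 1 else if (∃ y ∈ e, y ∈ ({x} : Finset (Fin n))) then 0 else u e)).real (⋃ v ∈ T ∪ B, openConn v b)
          + (∑ W ∈ (Finset.univ : Finset (Finset (Fin n))).filter (fun W => Disjoint W A),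
              (prodBernoulli (fun e : Sym2 (Fin n) => if (∀ y ∈ e, y ∈ B) ∧ ¬ e.IsDiag then 1 else if (∃ y ∈ e, y ∈ ({x} : Finset (Fin n))) then 0 else u e)).real
                  {ω : BondConfig (Fin n) | ∀ z : Fin n, (z ∈ W ↔ ω ∈ ⋃ v ∈ T ∪ B, openConn v z)}
                * A.inf' ⟨b, hb⟩ (fun a => (prodBernoulli (fun e : Sym2 (Fin n) => if (∀ y ∈ e, y ∈ B) ∧ ¬ e.IsDiag then 1 else if (∃ y ∈ e, y ∈ ({x} : Finset (Fin n))) then 0 else u e)).real (openConnIn ((W : Set (Fin n))ᶜ) a b)))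
          - ((prodBernoulli (fun e : Sym2 (Fin n) => if (∀ y ∈ e, y ∈ B) ∧ ¬ e.IsDiag then 1 else if (∃ y ∈ e, y ∈ ({x} : Finset (Fin n))) then 0 else u e)).real (openConn d b)
                + (prodBernoulli (fun e : Sym2 (Fin n) => if (∀ y ∈ e, y ∈ B) ∧ ¬ e.IsDiag then 1 else if (∃ y ∈ e, y ∈ ({x} : Finset (Fin n))) then 0 else u e)).real
                    ((openConn d b)ᶜ ∩ (⋃ v ∈ T ∪ B, openConn d v) ∩ (⋃ v ∈ T ∪ B, openConn v b)))) →
      (prodBernoulli u).real (openConn d b)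
          + (prodBernoulli u).real
              ((openConn d b)ᶜ ∩ (⋃ v ∈ insert x T, openConn d v) ∩ (⋃ v ∈ insert x T, openConn v b))
        ≤ (prodBernoulli u).real (⋃ v ∈ insert x T, openConn v b)
          + (∑ W ∈ (Finset.univ : Finset (Finset (Fin n))).filter (fun W => Disjoint W A),
              (prodBernoulli u).real
                  {ω : BondConfig (Fin n) | ∀ z : Fin n, (z ∈ W ↔ ω ∈ ⋃ v ∈ insert x T, openConn v z)}
                * A.inf' ⟨b, hb⟩ (fun a => (prodBernoulli u).real (openConnIn ((W : Set (Fin n))ᶜ) a b))) := by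
  intro n u A T x b d hb c hxT hxA hdx hsum hc
  have hbx : b ≠ x := fun h => hxA (h ▸ hb)
  rw [stub_bystanderDesignated_c5 n u T x b d hxT hbx hdx, stub_bystanderReach_c5 n u T x b hxT hbx,
    stub_bystanderPockets_c5 n u A T x b hb hxT hxA, ← Finset.sum_add_distrib]
  have key : ∀ B : Finset (Fin n),
      (prodBernoulli u).real {ω : BondConfig (Fin n) | ∀ y : Fin n, y ∈ B ↔ (y ∉ ({x} : Finset (Fin n)) ∧
          ∃ o ∈ ({x} : Finset (Fin n)), s(o, y) ∈ ω)} * c B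
      ≤ (prodBernoulli u).real {ω : BondConfig (Fin n) | ∀ y : Fin n, y ∈ B ↔ (y ∉ ({x} : Finset (Fin n)) ∧
          ∃ o ∈ ({x} : Finset (Fin n)), s(o, y) ∈ ω)}
        * ((prodBernoulli (fun e : Sym2 (Fin n) =>
              if (∀ y ∈ e, y ∈ B) ∧ ¬ e.IsDiag then 1 else
                if (∃ y ∈ e, y ∈ ({x} : Finset (Fin n))) then 0 else u e)).real (⋃ v ∈ T ∪ B, openConn v b)
          + (∑ W ∈ (Finset.univ : Finset (Finset (Fin n))).filter (fun W => Disjoint W A),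
              (prodBernoulli (fun e : Sym2 (Fin n) =>
                  if (∀ y ∈ e, y ∈ B) ∧ ¬ e.IsDiag then 1 else
                    if (∃ y ∈ e, y ∈ ({x} : Finset (Fin n))) then 0 else u e)).real
                  {ω : BondConfig (Fin n) | ∀ z : Fin n, (z ∈ W ↔ ω ∈ ⋃ v ∈ T ∪ B, openConn v z)}
                * A.inf' ⟨b, hb⟩ (fun a => (prodBernoulli (fun e : Sym2 (Fin n) =>
                    if (∀ y ∈ e, y ∈ B) ∧ ¬ e.IsDiag then 1 else
                      if (∃ y ∈ e, y ∈ ({x} : Finset (Fin n))) then 0 else u e)).real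
                    (openConnIn ((W : Set (Fin n))ᶜ) a b)))
          - ((prodBernoulli (fun e : Sym2 (Fin n) =>
              if (∀ y ∈ e, y ∈ B) ∧ ¬ e.IsDiag then 1 else
                if (∃ y ∈ e, y ∈ ({x} : Finset (Fin n))) then 0 else u e)).real (openConn d b)
            + (prodBernoulli (fun e : Sym2 (Fin n) =>
              if (∀ y ∈ e, y ∈ B) ∧ ¬ e.IsDiag then 1 else
                if (∃ y ∈ e, y ∈ ({x} : Finset (Fin n))) then 0 else u e)).real
                ((openConn d b)ᶜ ∩ (⋃ v ∈ T ∪ B, openConn d v) ∩ (⋃ v ∈ T ∪ B, openConn v b)))) := by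
    intro B
    by_cases h0 : (prodBernoulli u).real {ω : BondConfig (Fin n) | ∀ y : Fin n, y ∈ B ↔ (y ∉ ({x} : Finset (Fin n)) ∧
          ∃ o ∈ ({x} : Finset (Fin n)), s(o, y) ∈ ω)} = 0
    · rw [h0, zero_mul, zero_mul]
    · exact mul_le_mul_of_nonneg_left (hc B h0) measureReal_nonneg
  have h2 := Finset.sum_le_sum fun B (_ : B ∈ (Finset.univ : Finset (Finset (Fin n)))) => key B
  have h3 : ∑ B : Finset (Fin n),
      (prodBernoulli u).real {ω : BondConfig (Fin n) | ∀ y : Fin n, y ∈ B ↔ (y ∉ ({x} : Finset (Fin n)) ∧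
          ∃ o ∈ ({x} : Finset (Fin n)), s(o, y) ∈ ω)}
        * ((prodBernoulli (fun e : Sym2 (Fin n) =>
              if (∀ y ∈ e, y ∈ B) ∧ ¬ e.IsDiag then 1 else
                if (∃ y ∈ e, y ∈ ({x} : Finset (Fin n))) then 0 else u e)).real (⋃ v ∈ T ∪ B, openConn v b)
          + (∑ W ∈ (Finset.univ : Finset (Finset (Fin n))).filter (fun W => Disjoint W A),
              (prodBernoulli (fun e : Sym2 (Fin n) =>
                  if (∀ y ∈ e, y ∈ B) ∧ ¬ e.IsDiag then 1 else
                    if (∃ y ∈ e, y ∈ ({x} : Finset (Fin n))) then 0 else u e)).real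
                  {ω : BondConfig (Fin n) | ∀ z : Fin n, (z ∈ W ↔ ω ∈ ⋃ v ∈ T ∪ B, openConn v z)}
                * A.inf' ⟨b, hb⟩ (fun a => (prodBernoulli (fun e : Sym2 (Fin n) =>
                    if (∀ y ∈ e, y ∈ B) ∧ ¬ e.IsDiag then 1 else
                      if (∃ y ∈ e, y ∈ ({x} : Finset (Fin n))) then 0 else u e)).real
                    (openConnIn ((W : Set (Fin n))ᶜ) a b)))
          - ((prodBernoulli (fun e : Sym2 (Fin n) =>
              if (∀ y ∈ e, y ∈ B) ∧ ¬ e.IsDiag then 1 else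
                if (∃ y ∈ e, y ∈ ({x} : Finset (Fin n))) then 0 else u e)).real (openConn d b)
            + (prodBernoulli (fun e : Sym2 (Fin n) =>
              if (∀ y ∈ e, y ∈ B) ∧ ¬ e.IsDiag then 1 else
                if (∃ y ∈ e, y ∈ ({x} : Finset (Fin n))) then 0 else u e)).real
                ((openConn d b)ᶜ ∩ (⋃ v ∈ T ∪ B, openConn d v) ∩ (⋃ v ∈ T ∪ B, openConn v b))))
      = ∑ B : Finset (Fin n),
          ((prodBernoulli u).real {ω : BondConfig (Fin n) | ∀ y : Fin n, y ∈ B ↔ (y ∉ ({x} : Finset (Fin n)) ∧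
              ∃ o ∈ ({x} : Finset (Fin n)), s(o, y) ∈ ω)}
            * (prodBernoulli (fun e : Sym2 (Fin n) =>
              if (∀ y ∈ e, y ∈ B) ∧ ¬ e.IsDiag then 1 else
                if (∃ y ∈ e, y ∈ ({x} : Finset (Fin n))) then 0 else u e)).real (⋃ v ∈ T ∪ B, openConn v b)
          + (prodBernoulli u).real {ω : BondConfig (Fin n) | ∀ y : Fin n, y ∈ B ↔ (y ∉ ({x} : Finset (Fin n)) ∧
              ∃ o ∈ ({x} : Finset (Fin n)), s(o, y) ∈ ω)}
            * (∑ W ∈ (Finset.univ : Finset (Finset (Fin n))).filter (fun W => Disjoint W A),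
              (prodBernoulli (fun e : Sym2 (Fin n) =>
                  if (∀ y ∈ e, y ∈ B) ∧ ¬ e.IsDiag then 1 else
                    if (∃ y ∈ e, y ∈ ({x} : Finset (Fin n))) then 0 else u e)).real
                  {ω : BondConfig (Fin n) | ∀ z : Fin n, (z ∈ W ↔ ω ∈ ⋃ v ∈ T ∪ B, openConn v z)}
                * A.inf' ⟨b, hb⟩ (fun a => (prodBernoulli (fun e : Sym2 (Fin n) =>
                    if (∀ y ∈ e, y ∈ B) ∧ ¬ e.IsDiag then 1 else
                      if (∃ y ∈ e, y ∈ ({x} : Finset (Fin n))) then 0 else u e)).real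
                    (openConnIn ((W : Set (Fin n))ᶜ) a b))))
        - ∑ B : Finset (Fin n),
          (prodBernoulli u).real {ω : BondConfig (Fin n) | ∀ y : Fin n, y ∈ B ↔ (y ∉ ({x} : Finset (Fin n)) ∧
              ∃ o ∈ ({x} : Finset (Fin n)), s(o, y) ∈ ω)}
            * ((prodBernoulli (fun e : Sym2 (Fin n) =>
              if (∀ y ∈ e, y ∈ B) ∧ ¬ e.IsDiag then 1 else
                if (∃ y ∈ e, y ∈ ({x} : Finset (Fin n))) then 0 else u e)).real (openConn d b)
            + (prodBernoulli (fun e : Sym2 (Fin n) =>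
              if (∀ y ∈ e, y ∈ B) ∧ ¬ e.IsDiag then 1 else
                if (∃ y ∈ e, y ∈ ({x} : Finset (Fin n))) then 0 else u e)).real
                ((openConn d b)ᶜ ∩ (⋃ v ∈ T ∪ B, openConn d v) ∩ (⋃ v ∈ T ∪ B, openConn v b))) := by
    rw [← Finset.sum_sub_distrib]
    refine Finset.sum_congr rfl fun B _ => ?_
    ring
  rw [h3] at h2
  linarith


/-- Registered stub `stub_bystanderGood_c5` of crux stmt-CriticalPhenomena-4576 (lead c5, line `peel`, skeleton v4): **bystander
attachment at a fixed designation** (fully spelled statement; = `blockGood_insert_of_unglued`). [cite: KozmaNitzan2024, §3.2 pp. 13–14] -/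
theorem stub_bystanderGood_c5 :
    ∀ (n : ℕ) (u : Sym2 (Fin n) → unitInterval) (A T : Finset (Fin n)) (x b d : Fin n) (hb : b ∈ A),
      x ∉ T → x ∉ A → d ≠ x →
      (∀ B : Finset (Fin n),
        (prodBernoulli u).real
          {ω : BondConfig (Fin n) | ∀ y : Fin n, y ∈ B ↔ (y ∉ ({x} : Finset (Fin n)) ∧
            ∃ o ∈ ({x} : Finset (Fin n)), s(o, y) ∈ ω)} ≠ 0 →
        (prodBernoulli (fun e : Sym2 (Fin n) => if (∃ y ∈ e, y ∈ ({x} : Finset (Fin n))) then (0 : unitInterval) else u e)).real (openConn d b)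
          + (prodBernoulli (fun e : Sym2 (Fin n) => if (∃ y ∈ e, y ∈ ({x} : Finset (Fin n))) then (0 : unitInterval) else u e)).real
              ((openConn d b)ᶜ ∩ (⋃ v ∈ T ∪ B, openConn d v) ∩ (⋃ v ∈ T ∪ B, openConn v b))
        ≤ (prodBernoulli (fun e : Sym2 (Fin n) => if (∃ y ∈ e, y ∈ ({x} : Finset (Fin n))) then (0 : unitInterval) else u e)).real (⋃ v ∈ T ∪ B, openConn v b)
          + (∑ W ∈ (Finset.univ : Finset (Finset (Fin n))).filter (fun W => Disjoint W A),
              (prodBernoulli (fun e : Sym2 (Fin n) => if (∃ y ∈ e, y ∈ ({x} : Finset (Fin n))) then (0 : unitInterval) else u e)).real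
                  {ω : BondConfig (Fin n) | ∀ z : Fin n, (z ∈ W ↔ ω ∈ ⋃ v ∈ T ∪ B, openConn v z)}
                * A.inf' ⟨b, hb⟩ (fun a => (prodBernoulli (fun e : Sym2 (Fin n) => if (∃ y ∈ e, y ∈ ({x} : Finset (Fin n))) then (0 : unitInterval) else u e)).real (openConnIn ((W : Set (Fin n))ᶜ) a b)))) →
      (prodBernoulli u).real (openConn d b)
          + (prodBernoulli u).real
              ((openConn d b)ᶜ ∩ (⋃ v ∈ insert x T, openConn d v) ∩ (⋃ v ∈ insert x T, openConn v b))
        ≤ (prodBernoulli u).real (⋃ v ∈ insert x T, openConn v b)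
          + (∑ W ∈ (Finset.univ : Finset (Finset (Fin n))).filter (fun W => Disjoint W A),
              (prodBernoulli u).real
                  {ω : BondConfig (Fin n) | ∀ z : Fin n, (z ∈ W ↔ ω ∈ ⋃ v ∈ insert x T, openConn v z)}
                * A.inf' ⟨b, hb⟩ (fun a => (prodBernoulli u).real (openConnIn ((W : Set (Fin n))ᶜ) a b))) :=
  fun _ u A T x b d hb hxT hxA hdx hU => blockGood_insert_of_unglued u A T x b d hb hxT hxA hdx hU

/-- Registered stub `stub_bystanderLayers_c5` of crux stmt-CriticalPhenomena-4576 (lead c5, skeleton v5): the weighted-layer form of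
bystander attachment (= `blockGood_insert_of_layers_weighted`). [cite: KozmaNitzan2024, §3.2 pp. 13–14] -/
theorem stub_bystanderLayers_c5 :
    ∀ (n : ℕ) (u : Sym2 (Fin n) → unitInterval) (A T : Finset (Fin n)) (x b d : Fin n) (hb : b ∈ A)
      (c : Finset (Fin n) → ℝ),
      x ∉ T → x ∉ A → d ≠ x →
      0 ≤ ∑ B : Finset (Fin n), (prodBernoulli u).real {ω : BondConfig (Fin n) | ∀ y : Fin n, y ∈ B ↔ (y ∉ ({x} : Finset (Fin n)) ∧ ∃ o ∈ ({x} : Finset (Fin n)), s(o, y) ∈ ω)} * c B →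
      (∀ B : Finset (Fin n), (prodBernoulli u).real {ω : BondConfig (Fin n) | ∀ y : Fin n, y ∈ B ↔ (y ∉ ({x} : Finset (Fin n)) ∧ ∃ o ∈ ({x} : Finset (Fin n)), s(o, y) ∈ ω)} ≠ 0 →
        c B ≤ (prodBernoulli (fun e : Sym2 (Fin n) => if (∀ y ∈ e, y ∈ B) ∧ ¬ e.IsDiag then 1 else if (∃ y ∈ e, y ∈ ({x} : Finset (Fin n))) then 0 else u e)).real (⋃ v ∈ T ∪ B, openConn v b)
          + (∑ W ∈ (Finset.univ : Finset (Finset (Fin n))).filter (fun W => Disjoint W A),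
              (prodBernoulli (fun e : Sym2 (Fin n) => if (∀ y ∈ e, y ∈ B) ∧ ¬ e.IsDiag then 1 else if (∃ y ∈ e, y ∈ ({x} : Finset (Fin n))) then 0 else u e)).real
                  {ω : BondConfig (Fin n) | ∀ z : Fin n, (z ∈ W ↔ ω ∈ ⋃ v ∈ T ∪ B, openConn v z)}
                * A.inf' ⟨b, hb⟩ (fun a => (prodBernoulli (fun e : Sym2 (Fin n) => if (∀ y ∈ e, y ∈ B) ∧ ¬ e.IsDiag then 1 else if (∃ y ∈ e, y ∈ ({x} : Finset (Fin n))) then 0 else u e)).real (openConnIn ((W : Set (Fin n))ᶜ) a b)))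
          - ((prodBernoulli (fun e : Sym2 (Fin n) => if (∀ y ∈ e, y ∈ B) ∧ ¬ e.IsDiag then 1 else if (∃ y ∈ e, y ∈ ({x} : Finset (Fin n))) then 0 else u e)).real (openConn d b)
                + (prodBernoulli (fun e : Sym2 (Fin n) => if (∀ y ∈ e, y ∈ B) ∧ ¬ e.IsDiag then 1 else if (∃ y ∈ e, y ∈ ({x} : Finset (Fin n))) then 0 else u e)).real
                    ((openConn d b)ᶜ ∩ (⋃ v ∈ T ∪ B, openConn d v) ∩ (⋃ v ∈ T ∪ B, openConn v b)))) →
      (prodBernoulli u).real (openConn d b)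
          + (prodBernoulli u).real
              ((openConn d b)ᶜ ∩ (⋃ v ∈ insert x T, openConn d v) ∩ (⋃ v ∈ insert x T, openConn v b))
        ≤ (prodBernoulli u).real (⋃ v ∈ insert x T, openConn v b)
          + (∑ W ∈ (Finset.univ : Finset (Finset (Fin n))).filter (fun W => Disjoint W A),
              (prodBernoulli u).real
                  {ω : BondConfig (Fin n) | ∀ z : Fin n, (z ∈ W ↔ ω ∈ ⋃ v ∈ insert x T, openConn v z)}
                * A.inf' ⟨b, hb⟩ (fun a => (prodBernoulli u).real (openConnIn ((W : Set (Fin n))ᶜ) a b))) :=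
  blockGood_insert_of_layers_weighted

end

end Summit.CriticalPhenomena.PercolationContinuityZ3.Theorems
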